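import Summits.HodgeConjecture.HodgeConjecture.Theorems.AnchorTransportVariationalHodgeCurveThickness
import Literature.AlgebraicGeometry.HodgeTheory.QuasiProjectiveOfAffine
import Literature.AlgebraicGeometry.Motives.CurveThroughTwoPoints
import Mathlib.Topology.JacobsonSpace

/-!
# Route AnchorTransport — `VariationalHodge` (stmt-HodgeConjecture-1076): the dominance form of the crux over affine bases

`AnchorTransportVariationalHodgeCurveThickness` proves the DOMINANCE FORM of the crux
`AnchorTransport.VariationalHodge` over smooth irreducible affine CURVE bases (granted the named fact
`charlesSchnell_algebraicityLocus_iUnion_closed`): if the fibre restrictions of a global class on a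
projective family are algebraic at all complex points over a non-empty Zariski open of the curve,
they are algebraic everywhere. This file lifts it to smooth irreducible AFFINE bases of any dimension,
granted in addition Mumford's lemma (`Motives.mumford_smoothCurve_through_two_points`): join a complex
point `u` over the open `U` to the target `t` by a smooth irreducible affine curve `g : C ⟶ S`,
base-change the family along `g` (`Motives.familyPullback`; again projective in Hartshorne's sense,
`Motives.exists_isClosedImmersion_familyPullback`, so its total space is quasi-projective over the
quasi-projective affine curve — `IsQuasiProjectiveOver.of_isAffine`,
`IsQuasiProjectiveOver.of_isClosedImmersion_projectiveSpace_tensor`), observe algebraicity over the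
non-empty open `g⁻¹ U ∋ u'` of `C`, apply curve dominance, and move the conclusion at `t'` back to `t`
across the isomorphism of fibres `(𝒳 ×_S C)_{t'} ≅ 𝒳_t`.

* `familyPullback_map_fiberι_mem_algebraicClasses_iff` — algebraicity of fibre restrictions is
  invariant under base change (the lemma `map_fiberι_familyPullback_mem_algebraicClasses_iff` of
  `AnchorTransportVariationalHodgeReductions`, re-derived from Literature lemmas only so that this file
  stays outside the route file's import cone);
* `exists_complexPoints_pt_mem_of_isOpen` — a non-empty Zariski open of a `ℂ`-scheme locally of
  finite type carries a complex point (Jacobson + Nullstellensatz);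
* `variationalHodge_dominance_of_open` — **DominanceFormOfV over smooth irreducible affine bases**
  for families projective in Hartshorne's sense: algebraic over a non-empty Zariski open ⇒ algebraic
  at every complex point (modulo the Charles–Schnell fact and Mumford's lemma);
  `variationalHodge_dominance_of_open_of_irreducible` — the same over EVERY smooth irreducible base
  (affine opens through the target point meet the open; restriction to them). This is the typed
  input `DominanceFormOfV` (card `exact-reduced-dimension-transport`), `AnalyticInteriorForcesAll`'s
  use (card `cusp-driven-log-transport`, Zariski-open case), `LocalToGlobal` (card
  `polar-patch-broken-cycles`) and the closing step of `nodal-carrier-equisingular-transport`, in the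
  affine setting to which `AnchorTransportVariationalHodgeReductions` reduces the crux.
-/

noncomputable section

-- every declaration of this problem lives in `Summit.HodgeConjecture.HodgeConjecture.…` (summit = sub-problem)
set_option linter.dupNamespace false

open CategoryTheory AlgebraicGeometry TopologicalSpace MonoidalCategory
open Literature.AlgebraicGeometry.Motives Literature.AlgebraicGeometry.HodgeTheory

namespace Summit.HodgeConjecture.HodgeConjecture.Theorems

variable {n p : ℕ} {𝒳 S S' : SchemeOver ℂ}

/-- **Algebraicity of the restrictions is invariant under base change** (re-derivation of
`map_fiberι_familyPullback_mem_algebraicClasses_iff` from Literature lemmas: `map_fiberι_familyPullback`,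
`mem_algebraicClasses_map_of_iso`, `map_hom_map_inv_apply`): for a smooth projective family `f` and
`g : S' ⟶ S`, the restriction of `pr_𝒳^* A` to `(𝒳 ×_S S')_{s'}` is algebraic iff the restriction of
`A` to `𝒳_{g s'}` is. [folklore] -/
theorem familyPullback_map_fiberι_mem_algebraicClasses_iff (f : 𝒳 ⟶ S) (g : S' ⟶ S)
    (hf : IsSmoothProjectiveFamily f n) (A : complexBetti 𝒳 (2 * p)) (s' : ComplexPoints S') :
    complexBetti.map (fiberι (familyPullback.snd f g) s') (2 * p)
        (complexBetti.map (familyPullback.fst f g) (2 * p) A) ∈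
          algebraicClasses (fiberOver (familyPullback.snd f g) s') p ↔
      complexBetti.map (fiberι f (AlgPoints.map g s')) (2 * p) A ∈
        algebraicClasses (fiberOver f (AlgPoints.map g s')) p := by
  rw [map_fiberι_familyPullback]
  refine ⟨fun h => ?_, fun h => mem_algebraicClasses_map_of_iso (hf.isSmoothProjective _)
    ((hf.familyPullback_snd g).isSmoothProjective s') (fiberOverFamilyPullbackIso f g s') h⟩
  have back := mem_algebraicClasses_map_of_iso ((hf.familyPullback_snd g).isSmoothProjective s')
    (hf.isSmoothProjective _) (fiberOverFamilyPullbackIso f g s').symm h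
  have hid : complexBetti.map (fiberOverFamilyPullbackIso f g s').symm.hom (2 * p)
      (complexBetti.map (fiberOverFamilyPullbackIso f g s').hom (2 * p)
        (complexBetti.map (fiberι f (AlgPoints.map g s')) (2 * p) A)) =
      complexBetti.map (fiberι f (AlgPoints.map g s')) (2 * p) A :=
    map_hom_map_inv_apply (fiberOverFamilyPullbackIso f g s').symm (2 * p) _
  rwa [hid] at back

/-- **A non-empty Zariski open of a `ℂ`-scheme locally of finite type carries a complex point**: it
contains a closed point (schemes locally of finite type over a field are Jacobson, Mathlib
`nonempty_inter_closedPoints`), which underlies a complex point (Nullstellensatz,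
`ComplexPoints.equivClosedPoints`). [folklore] -/
theorem exists_complexPoints_pt_mem_of_isOpen [LocallyOfFiniteType S.hom] {U : Set S.left}
    (hU : IsOpen U) (hUne : U.Nonempty) : ∃ u : ComplexPoints S, u.pt ∈ U := by
  haveI : JacobsonSpace S.left := LocallyOfFiniteType.jacobsonSpace S.hom
  obtain ⟨y, hyU, hy⟩ := nonempty_inter_closedPoints hUne hU.isLocallyClosed
  refine ⟨(ComplexPoints.equivClosedPoints S).symm ⟨y, hy⟩, ?_⟩
  have : ((ComplexPoints.equivClosedPoints S) ((ComplexPoints.equivClosedPoints S).symm ⟨y, hy⟩) :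
      S.left) = y := by rw [Equiv.apply_symm_apply]
  rw [ComplexPoints.coe_equivClosedPoints_apply] at this
  rwa [this]

/-- **The dominance form of the variational Hodge statement over smooth irreducible AFFINE bases.**
Granted `charlesSchnell_algebraicityLocus_iUnion_closed` and Mumford's lemma
`Motives.mumford_smoothCurve_through_two_points`: let `f : 𝒳 ⟶ S` be a smooth projective family of
relative dimension `n`, projective in Hartshorne's sense (a closed immersion into `ℙᴺ × S` followed by
the projection), over a smooth irreducible affine `ℂ`-scheme `S`, and `A ∈ H²ᵖ(𝒳(ℂ); ℂ)`. If
`A|_{𝒳_t}` is algebraic for every complex point `t` over a non-empty Zariski open `U ⊆ S`, then it is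
algebraic for EVERY complex point `t`. Proof: pick `u ∈ S(ℂ)` over `U`
(`exists_complexPoints_pt_mem_of_isOpen`); if `t = u` we are done; otherwise join `u`, `t` by a smooth
irreducible affine curve `g : C ⟶ S` (Mumford), base-change the family to `C` (projective over `C`,
hence with quasi-projective total space, `C` being affine hence quasi-projective), note that the
restrictions of `pr_𝒳^* A` are algebraic over the non-empty open `g⁻¹ U ∋ u'`
(`familyPullback_map_fiberι_mem_algebraicClasses_iff`), apply `variationalHodge_curve_dominance_of_open`
(`C` has Krull dimension `1`) and come back to `t`. [cite: CharlesSchnell2014Notes, Prop. 11.3.11 (proof)]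
[cite: MumfordAV1970, §6, Lemma] -/
theorem variationalHodge_dominance_of_open (hCS : charlesSchnell_algebraicityLocus_iUnion_closed)
    (hM : mumford_smoothCurve_through_two_points) (f : 𝒳 ⟶ S) (hf : IsSmoothProjectiveFamily f n)
    (hι : ∃ (N : ℕ) (ι : 𝒳 ⟶ projectiveSpace N ℂ ⊗ S), IsClosedImmersion ι.left ∧
      ι ≫ CartesianMonoidalCategory.snd (projectiveSpace N ℂ) S = f)
    [IsAffine S.left] [IrreducibleSpace S.left] [AlgebraicGeometry.Smooth S.hom]
    (A : complexBetti 𝒳 (2 * p)) {U : Set S.left} (hU : IsOpen U) (hUne : U.Nonempty)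
    (halg : ∀ t : ComplexPoints S, t.pt ∈ U →
      complexBetti.map (fiberι f t) (2 * p) A ∈ algebraicClasses (fiberOver f t) p)
    (t : ComplexPoints S) :
    complexBetti.map (fiberι f t) (2 * p) A ∈ algebraicClasses (fiberOver f t) p := by
  -- a complex point `u` over `U`
  obtain ⟨u, hu⟩ := exists_complexPoints_pt_mem_of_isOpen hU hUne
  by_cases htu : u = t
  · exact htu ▸ halg u hu
  -- a smooth irreducible affine curve through `u` and `t`
  obtain ⟨C, g, u', t', hCaff, hCirr, hCsm, hCdim, rfl, rfl⟩ := hM.of_irreducibleSpace u t htu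
  haveI := hCaff
  haveI := hCirr
  haveI := hCsm
  -- base change to `C`; quasi-projectivity of the new total space and base
  have hf' := hf.familyPullback_snd g
  obtain ⟨N, ι', hι', -⟩ := exists_isClosedImmersion_familyPullback f g hι
  haveI := hι'
  have hCqp : IsQuasiProjectiveOver C := IsQuasiProjectiveOver.of_isAffine C
  have h𝒳'qp : IsQuasiProjectiveOver (familyPullback f g) :=
    IsQuasiProjectiveOver.of_isClosedImmersion_projectiveSpace_tensor ι' hCqp
  -- algebraicity over the non-empty open `g⁻¹ U` of `C`
  have hU' : IsOpen (g.left.base ⁻¹' U) := hU.preimage g.left.base.hom.continuous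
  have hU'ne : (g.left.base ⁻¹' U).Nonempty := ⟨u'.pt, hu⟩
  have halg' : ∀ c : ComplexPoints C, c.pt ∈ g.left.base ⁻¹' U →
      complexBetti.map (fiberι (familyPullback.snd f g) c) (2 * p)
          (complexBetti.map (familyPullback.fst f g) (2 * p) A) ∈
        algebraicClasses (fiberOver (familyPullback.snd f g) c) p := fun c hc =>
    (familyPullback_map_fiberι_mem_algebraicClasses_iff f g hf A c).2 (halg (AlgPoints.map g c) hc)
  -- curve dominance at `t'`, and back to `t = g t'`
  exact (familyPullback_map_fiberι_mem_algebraicClasses_iff f g hf A t').1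
    (variationalHodge_curve_dominance_of_open hCS (familyPullback.snd f g) hf' h𝒳'qp hCqp hCdim
      (complexBetti.map (familyPullback.fst f g) (2 * p) A) hU' hU'ne halg' t')

/-- **The dominance form of the variational Hodge statement over ALL smooth irreducible bases**
(families projective in Hartshorne's sense; granted the Charles–Schnell fact and Mumford's lemma):
if `A|_{𝒳_t}` is algebraic at every complex point over a non-empty Zariski open `U ⊆ S`, then at every
complex point `t`. Reduction to the affine case `variationalHodge_dominance_of_open`: the point `pt t`
lies in an affine open `W ⊆ S`; `W` meets `U` (`S` is irreducible); restrict the family to `W`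
(`Motives.openSubschemeOver`, a smooth irreducible affine `ℂ`-scheme; the restriction is the base
change along the open immersion `W ⟶ S`, again projective in Hartshorne's sense), lift `t` to `W`
(`AlgPoints.liftOfMemOpensRange`), use algebraicity over the non-empty open `U ∩ W` of `W`, and move
the conclusion back (`familyPullback_map_fiberι_mem_algebraicClasses_iff`). Neither separatedness nor
quasi-compactness of `S` is needed. [cite: CharlesSchnell2014Notes, Prop. 11.3.11 (proof)]
[cite: MumfordAV1970, §6, Lemma] -/
theorem variationalHodge_dominance_of_open_of_irreducible
    (hCS : charlesSchnell_algebraicityLocus_iUnion_closed)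
    (hM : mumford_smoothCurve_through_two_points) (f : 𝒳 ⟶ S) (hf : IsSmoothProjectiveFamily f n)
    (hι : ∃ (N : ℕ) (ι : 𝒳 ⟶ projectiveSpace N ℂ ⊗ S), IsClosedImmersion ι.left ∧
      ι ≫ CartesianMonoidalCategory.snd (projectiveSpace N ℂ) S = f)
    [IrreducibleSpace S.left] [AlgebraicGeometry.Smooth S.hom]
    (A : complexBetti 𝒳 (2 * p)) {U : Set S.left} (hU : IsOpen U) (hUne : U.Nonempty)
    (halg : ∀ t : ComplexPoints S, t.pt ∈ U →
      complexBetti.map (fiberι f t) (2 * p) A ∈ algebraicClasses (fiberOver f t) p)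
    (t : ComplexPoints S) :
    complexBetti.map (fiberι f t) (2 * p) A ∈ algebraicClasses (fiberOver f t) p := by
  -- an affine open `W ∋ pt t`; it meets `U`
  obtain ⟨W, hW, htW, -⟩ := exists_isAffineOpen_mem_and_subset (U := ⊤) (x := t.pt) trivial
  have hWU : ((W : Set S.left) ∩ U).Nonempty := by
    obtain ⟨x, -, hxW, hxU⟩ := (PreirreducibleSpace.isPreirreducible_univ (X := S.left)) _ _
      W.isOpen hU ⟨t.pt, Set.mem_univ _, htW⟩ (let ⟨u, hu⟩ := hUne; ⟨u, Set.mem_univ _, hu⟩)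
    exact ⟨x, hxW, hxU⟩
  -- the open subscheme `W` as a smooth irreducible affine `ℂ`-scheme `g : W ⟶ S`
  set g := openSubschemeOverι S W with hg
  haveI : IsOpenImmersion g.left := inferInstanceAs (IsOpenImmersion W.ι)
  haveI hWaff : IsAffine (openSubschemeOver S W).left := hW
  haveI hWirr : IrreducibleSpace (openSubschemeOver S W).left := by
    change IrreducibleSpace W
    exact isIrreducible_iff_irreducibleSpace.mp ⟨⟨t.pt, htW⟩,
      (PreirreducibleSpace.isPreirreducible_univ (X := S.left)).open_subset W.isOpen
        (Set.subset_univ _)⟩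
  haveI hWsm : AlgebraicGeometry.Smooth (openSubschemeOver S W).hom := by
    change AlgebraicGeometry.Smooth (W.ι ≫ S.hom)
    infer_instance
  -- lift `t` to `W`
  obtain ⟨t', rfl⟩ : ∃ t' : ComplexPoints (openSubschemeOver S W), AlgPoints.map g t' = t :=
    ⟨AlgPoints.liftOfMemOpensRange g t ⟨⟨t.pt, htW⟩, rfl⟩, AlgPoints.map_liftOfMemOpensRange g t _⟩
  -- base change to `W` and the affine dominance over the open `W ∩ U` of `W`
  have hU' : IsOpen (g.left.base ⁻¹' U) := hU.preimage g.left.base.hom.continuous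
  have hU'ne : (g.left.base ⁻¹' U).Nonempty := by
    obtain ⟨x, hxW, hxU⟩ := hWU
    exact ⟨⟨x, hxW⟩, hxU⟩
  rw [← familyPullback_map_fiberι_mem_algebraicClasses_iff f g hf A t']
  exact variationalHodge_dominance_of_open hCS hM (familyPullback.snd f g) (hf.familyPullback_snd g)
    (exists_isClosedImmersion_familyPullback f g hι)
    (complexBetti.map (familyPullback.fst f g) (2 * p) A) hU' hU'ne
    (fun c hc => (familyPullback_map_fiberι_mem_algebraicClasses_iff f g hf A c).2
      (halg (AlgPoints.map g c) hc)) t'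

end Summit.HodgeConjecture.HodgeConjecture.Theorems

end
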